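import Summits.QuantumFields.YangMills.Theorems.SourcedPressureJensenSourcedPressureIncrementGaussSecondCumulant
import Literature.Analysis.FunctionSpaces.SquaredBesselExistence
import Mathlib.Algebra.Order.Chebyshev
import HarnessLib

/-!
# `SourcedPressureIncrement` (stmt-QuantumFields-22517), line `birth`: UNIFORM MOMENT BOUNDS for the site terms of the Gaussian
# source (file 1/2 of the windowed Gaussian increment `…GaussIncrementWindow`)

Helper toward the deciding crux stmt-QuantumFields-22517 (`SourcedPressureJensen.SourcedPressureIncrement`; free-cell children
KS1′ stmt-QuantumFields-23996 / KS2′ stmt-QuantumFields-24028).  For the curvature Gaussian field `γ = curvatureGaussianField 4 D` and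
the site terms `X_x = A_xA_{x+ne₀}`, `A_x = (λ/2)|Y(p₁₂x)|² − (λ/2)·D·C(0)`, of the source of `gaussIncrement`:

* `sub_pow_eight_le`, `pow_four_mul_pow_four_le` — power means (with the tree's `pow_four_sub_le`);
* `integral_eval_pow_sixteen` — `E_γ[(Y_p^a)^{16}] = 15!!·(1/2)⁸` (Wick, `GaussianWick.integral_pow_even_eq`; `C(p,p) = 1/2` in `d = 4`);
* `integral_centredColourSq_pow_eight_le` — `E_γ[A_p⁸] ≤ K₈(D, λ)` for every plaquette `p`;
* `integral_siteTerm_sub_pow_four_le` — `E_γ[(A_pA_q − m)⁴] ≤ 8(K₈ + m⁴)` for all `p, q, m`;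
* **`integral_centredSource_pow_four_le`** — `E_γ[(Σ_{x∈B}(X_x − m))⁴] ≤ |B|⁴·8(K₈ + m⁴)` for every `n`, finite `B` and `m`
  (crude in `|B|` — the truth is `O(|B|²)` — but uniform in the separation, which is what the window `h·|B| ≤ h₀` needs).

RECORD-label rung support (all-`G` leaf `WeakCouplingRates.XiPow`); the Yang–Mills mass gap is NOT proved by anything here.
Source: S. Janson, *Gaussian Hilbert Spaces* (1997) Rem. 1.30. [folklore]
-/

noncomputable section

open MeasureTheory ProbabilityTheory Real
open scoped Nat
open Literature.Probability.Distributions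
open Literature.MathematicalPhysics.QuantumFieldTheory Literature.MathematicalPhysics.QuantumLattice
open Literature.Probability.LatticeModels Literature.Barriers.CriticalPhenomena

namespace Summit.QuantumFields.YangMills.Cruxes.SourcedPressureIncrement.Birth

/-! ### §1 Elementary power inequalities -/

/-- `(a − b)⁸ ≤ 128(a⁸ + b⁸)`. [folklore] -/
theorem sub_pow_eight_le (a b : ℝ) : (a - b) ^ 8 ≤ 128 * (a ^ 8 + b ^ 8) := by
  have h1 : (a - b) ^ 8 = ((a - b) ^ 4) ^ 2 := by ring
  have h2 := Literature.Analysis.FunctionSpaces.pow_four_sub_le a b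
  have h3 : 0 ≤ (a - b) ^ 4 := by positivity
  have h4 : ((a - b) ^ 4) ^ 2 ≤ (8 * (a ^ 4 + b ^ 4)) ^ 2 := pow_le_pow_left₀ h3 h2 2
  nlinarith [sq_nonneg (a ^ 4 - b ^ 4)]

/-- `a⁴ b⁴ ≤ (a⁸ + b⁸)/2`. [folklore] -/
theorem pow_four_mul_pow_four_le (a b : ℝ) : a ^ 4 * b ^ 4 ≤ (a ^ 8 + b ^ 8) / 2 := by
  nlinarith [sq_nonneg (a ^ 4 - b ^ 4)]

/-! ### §2 Uniform moment bounds for the site terms of the Gaussian source (`d = 4`) -/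

section Moments

/-- **Sixteenth moment of a plaquette variable**: `E_γ[(Y_p^a)^{16}] = 15!! · C(p,p)⁸ = 15!!/2⁸` in `d = 4` (`C(p,p) = 1/2`).
[cite: Janson1997, Rem. 1.30] -/
theorem integral_eval_pow_sixteen (D : ℕ) (p : ZdPlaquette 4) (a : Fin D) :
    ∫ Y, (Y p a) ^ 16 ∂curvatureGaussianField (d := 4) D = ((15‼ : ℕ) : ℝ) * (1 / 2) ^ 8 := by
  have hd : 3 ≤ 4 := by norm_num
  have hX := isGaussianProcess_eval_curvatureGaussianField (d := 4) hd D
  have h0 := integral_evalProcess_curvatureGaussianField (d := 4) hd D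
  have h := GaussianWick.integral_pow_even_eq hX h0 (p, a) 8
  have h2 : ∫ Y, (fun (s : ZdPlaquette 4 × Fin D) (Y : ZdPlaquette 4 → Fin D → ℝ) => Y s.1 s.2) (p, a) Y ^ 2
      ∂curvatureGaussianField (d := 4) D = 1 / 2 := by
    simp only [pow_two]
    rw [integral_eval_mul_eval_curvatureGaussianField hd, if_pos rfl, curvatureTwoPoint_self hd]
    norm_num
  rw [h2] at h
  simpa using h

/-- **Uniform eighth moment of the centred colour square**: `E_γ[A_p⁸] ≤ K₈(D, λ)` for every plaquette `p`, with
`A_p = (λ/2)|Y_p|² − (λ/2)·D·C(0)` (power means and `integral_eval_pow_sixteen`). [folklore] -/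
theorem integral_centredColourSq_pow_eight_le (D : ℕ) (lam : ℝ) (p : ZdPlaquette 4) :
    Integrable (fun Y : ZdPlaquette 4 → Fin D → ℝ =>
        (lam / 2 * (∑ a : Fin D, (Y p a) ^ 2) - lam / 2 * D * curvaturePlaquetteCorr (d := 4) (by norm_num) 0) ^ 8)
      (curvatureGaussianField (d := 4) D) ∧
    ∫ Y, (lam / 2 * (∑ a : Fin D, (Y p a) ^ 2) - lam / 2 * D * curvaturePlaquetteCorr (d := 4) (by norm_num) 0) ^ 8
        ∂curvatureGaussianField (d := 4) D ≤
      128 * ((lam / 2) ^ 8 * ((D : ℝ) ^ 7 * (D * (((15‼ : ℕ) : ℝ) * (1 / 2) ^ 8))) +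
        (lam / 2 * D * curvaturePlaquetteCorr (d := 4) (by norm_num) 0) ^ 8) := by
  have hd : 3 ≤ 4 := by norm_num
  set γ := curvatureGaussianField (d := 4) D with hγ
  haveI := isProbabilityMeasure_curvatureGaussianField hd D
  have hX := isGaussianProcess_eval_curvatureGaussianField (d := 4) hd D
  set C0 : ℝ := curvaturePlaquetteCorr (d := 4) hd 0 with hC0
  -- integrability: polynomials in the plaquette variables
  have hI : ∀ q : MvPolynomial (Fin D) ℝ,
      Integrable (fun Y : ZdPlaquette 4 → Fin D → ℝ => MvPolynomial.eval (fun a => Y p a) q) γ := fun q =>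
    integrable_mvPolynomial_eval hX (fun a : Fin D => (p, a)) q
  have iA8 : Integrable (fun Y : ZdPlaquette 4 → Fin D → ℝ =>
      (lam / 2 * (∑ a : Fin D, (Y p a) ^ 2) - lam / 2 * D * C0) ^ 8) γ :=
    (hI ((MvPolynomial.C (lam / 2) * (∑ a : Fin D, MvPolynomial.X a ^ 2) - MvPolynomial.C (lam / 2 * D * C0)) ^ 8)).congr
      (ae_of_all _ fun Y => by simp [map_sum])
  have iS8 : Integrable (fun Y : ZdPlaquette 4 → Fin D → ℝ => (∑ a : Fin D, (Y p a) ^ 2) ^ 8) γ :=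
    (hI ((∑ a : Fin D, MvPolynomial.X a ^ 2) ^ 8)).congr (ae_of_all _ fun Y => by simp [map_sum])
  have i16 : ∀ a : Fin D, Integrable (fun Y : ZdPlaquette 4 → Fin D → ℝ => (Y p a) ^ 16) γ := fun a =>
    (hI (MvPolynomial.X a ^ 16)).congr (ae_of_all _ fun Y => by simp)
  refine ⟨iA8, ?_⟩
  -- pointwise: `A⁸ ≤ 128((λ/2)⁸ S⁸ + (λ/2 D C0)⁸)` and `S⁸ ≤ D⁷ Σ_a Y_a¹⁶`
  have hpt : ∀ Y : ZdPlaquette 4 → Fin D → ℝ,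
      (lam / 2 * (∑ a : Fin D, (Y p a) ^ 2) - lam / 2 * D * C0) ^ 8 ≤
        128 * ((lam / 2) ^ 8 * ((D : ℝ) ^ 7 * ∑ a : Fin D, (Y p a) ^ 16) + (lam / 2 * D * C0) ^ 8) := by
    intro Y
    have h1 := sub_pow_eight_le (lam / 2 * ∑ a : Fin D, (Y p a) ^ 2) (lam / 2 * D * C0)
    have h2 : (∑ a : Fin D, (Y p a) ^ 2) ^ 8 ≤ (D : ℝ) ^ 7 * ∑ a : Fin D, (Y p a) ^ 16 := by
      have h := pow_sum_le_card_mul_sum_pow (s := (Finset.univ : Finset (Fin D))) (f := fun a => (Y p a) ^ 2)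
        (fun a _ => sq_nonneg _) 7
      simp only [Finset.card_univ, Fintype.card_fin] at h
      refine h.trans (le_of_eq ?_)
      congr 1
      refine Finset.sum_congr rfl fun a _ => ?_
      ring
    have h3 : (lam / 2 * ∑ a : Fin D, (Y p a) ^ 2) ^ 8 = (lam / 2) ^ 8 * (∑ a : Fin D, (Y p a) ^ 2) ^ 8 := by ring
    have h4 : 0 ≤ (lam / 2) ^ 8 := by positivity
    nlinarith [mul_le_mul_of_nonneg_left h2 h4]
  have iR : Integrable (fun Y : ZdPlaquette 4 → Fin D → ℝ =>
      128 * ((lam / 2) ^ 8 * ((D : ℝ) ^ 7 * ∑ a : Fin D, (Y p a) ^ 16) + (lam / 2 * D * C0) ^ 8)) γ :=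
    ((((integrable_finsetSum _ fun a _ => i16 a).const_mul _).const_mul _).add (integrable_const _)).const_mul _
  refine (integral_mono iA8 iR hpt).trans (le_of_eq ?_)
  rw [integral_const_mul, integral_add (((integrable_finsetSum _ fun a _ => i16 a).const_mul _).const_mul _)
    (integrable_const _), integral_const_mul, integral_const_mul, integral_finsetSum _ (fun a _ => i16 a),
    integral_const, probReal_univ, one_smul]
  simp only [hγ, integral_eval_pow_sixteen, Finset.sum_const, Finset.card_univ, Fintype.card_fin, nsmul_eq_mul]

end Moments

/-- **Uniform fourth moment of one centred site term**: with `A_p = (λ/2)|Y_p|² − (λ/2)·D·C(0)` and any `m : ℝ`,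
`E_γ[(A_pA_q − m)⁴] ≤ 8·(K₈ + m⁴)`, `K₈` the eighth-moment bound of `integral_centredColourSq_pow_eight_le`
(`(X − m)⁴ ≤ 8(X⁴ + m⁴)`, `A_p⁴A_q⁴ ≤ (A_p⁸ + A_q⁸)/2`). [folklore] -/
theorem integral_siteTerm_sub_pow_four_le (D : ℕ) (lam m : ℝ) (p q : ZdPlaquette 4) :
    Integrable (fun Y : ZdPlaquette 4 → Fin D → ℝ =>
        ((lam / 2 * (∑ a : Fin D, (Y p a) ^ 2) - lam / 2 * D * curvaturePlaquetteCorr (d := 4) (by norm_num) 0) *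
            (lam / 2 * (∑ a : Fin D, (Y q a) ^ 2) - lam / 2 * D * curvaturePlaquetteCorr (d := 4) (by norm_num) 0) - m) ^ 4)
      (curvatureGaussianField (d := 4) D) ∧
    ∫ Y, ((lam / 2 * (∑ a : Fin D, (Y p a) ^ 2) - lam / 2 * D * curvaturePlaquetteCorr (d := 4) (by norm_num) 0) *
            (lam / 2 * (∑ a : Fin D, (Y q a) ^ 2) - lam / 2 * D * curvaturePlaquetteCorr (d := 4) (by norm_num) 0) - m) ^ 4
        ∂curvatureGaussianField (d := 4) D ≤
      8 * (128 * ((lam / 2) ^ 8 * ((D : ℝ) ^ 7 * (D * (((15‼ : ℕ) : ℝ) * (1 / 2) ^ 8))) +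
        (lam / 2 * D * curvaturePlaquetteCorr (d := 4) (by norm_num) 0) ^ 8) + m ^ 4) := by
  have hd : 3 ≤ 4 := by norm_num
  set γ := curvatureGaussianField (d := 4) D with hγ
  haveI := isProbabilityMeasure_curvatureGaussianField hd D
  have hX := isGaussianProcess_eval_curvatureGaussianField (d := 4) hd D
  set C0 : ℝ := curvaturePlaquetteCorr (d := 4) hd 0 with hC0
  set K8 : ℝ := 128 * ((lam / 2) ^ 8 * ((D : ℝ) ^ 7 * (D * (((15‼ : ℕ) : ℝ) * (1 / 2) ^ 8))) + (lam / 2 * D * C0) ^ 8)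
    with hK8
  obtain ⟨iAp, hAp⟩ := integral_centredColourSq_pow_eight_le D lam p
  obtain ⟨iAq, hAq⟩ := integral_centredColourSq_pow_eight_le D lam q
  -- the site polynomial
  set Ap : (ZdPlaquette 4 → Fin D → ℝ) → ℝ := fun Y => lam / 2 * (∑ a : Fin D, (Y p a) ^ 2) - lam / 2 * D * C0 with hApd
  set Aq : (ZdPlaquette 4 → Fin D → ℝ) → ℝ := fun Y => lam / 2 * (∑ a : Fin D, (Y q a) ^ 2) - lam / 2 * D * C0 with hAqd
  have hI : ∀ r : MvPolynomial (ZdPlaquette 4 × Fin D) ℝ,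
      Integrable (fun Y : ZdPlaquette 4 → Fin D → ℝ => MvPolynomial.eval (fun s => Y s.1 s.2) r) γ := fun r =>
    integrable_mvPolynomial_eval hX id r
  set rp : MvPolynomial (ZdPlaquette 4 × Fin D) ℝ :=
    MvPolynomial.C (lam / 2) * (∑ a : Fin D, MvPolynomial.X (p, a) ^ 2) - MvPolynomial.C (lam / 2 * D * C0) with hrp
  set rq : MvPolynomial (ZdPlaquette 4 × Fin D) ℝ :=
    MvPolynomial.C (lam / 2) * (∑ a : Fin D, MvPolynomial.X (q, a) ^ 2) - MvPolynomial.C (lam / 2 * D * C0) with hrq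
  have i4 : Integrable (fun Y => (Ap Y * Aq Y - m) ^ 4) γ :=
    (hI ((rp * rq - MvPolynomial.C m) ^ 4)).congr (ae_of_all _ fun Y => by simp [hrp, hrq, hApd, hAqd, map_sum])
  have iX4 : Integrable (fun Y => Ap Y ^ 4 * Aq Y ^ 4) γ :=
    (hI (rp ^ 4 * rq ^ 4)).congr (ae_of_all _ fun Y => by simp [hrp, hrq, hApd, hAqd, map_sum])
  refine ⟨i4, ?_⟩
  have hpt : ∀ Y, (Ap Y * Aq Y - m) ^ 4 ≤ 8 * ((Ap Y ^ 8 + Aq Y ^ 8) / 2 + m ^ 4) := by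
    intro Y
    have h1 := Literature.Analysis.FunctionSpaces.pow_four_sub_le (Ap Y * Aq Y) m
    have h2 := pow_four_mul_pow_four_le (Ap Y) (Aq Y)
    rw [mul_pow] at h1
    linarith
  have iR : Integrable (fun Y => 8 * ((Ap Y ^ 8 + Aq Y ^ 8) / 2 + m ^ 4)) γ :=
    ((((iAp.add iAq).div_const 2)).add (integrable_const _)).const_mul _
  calc ∫ Y, (Ap Y * Aq Y - m) ^ 4 ∂γ ≤ ∫ Y, 8 * ((Ap Y ^ 8 + Aq Y ^ 8) / 2 + m ^ 4) ∂γ := integral_mono i4 iR hpt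
    _ = 8 * (((∫ Y, Ap Y ^ 8 ∂γ) + ∫ Y, Aq Y ^ 8 ∂γ) / 2 + m ^ 4) := by
        have i12 : Integrable (fun Y => (Ap Y ^ 8 + Aq Y ^ 8) / 2) γ := (iAp.add iAq).div_const 2
        rw [integral_const_mul, integral_add i12 (integrable_const _), integral_const, probReal_univ, one_smul,
          integral_div, integral_add iAp iAq]
    _ ≤ 8 * (K8 + m ^ 4) := by nlinarith [hAp, hAq]

/-- **Uniform fourth central moment of the Gaussian source**: for every separation `n`, finite `B ⊂ ℤ⁴` and `m : ℝ`,
`E_γ[(Σ_{x∈B} (X_x − m))⁴] ≤ |B|⁴ · 8(K₈ + m⁴)` (power mean `(Σ_{x∈B} c_x)⁴ ≤ |B|³ Σ c_x⁴` and the site bound).  Crude (the truth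
is `O(|B|²)`), but uniform in `n` and enough in the window `h|B| ≤ h₀`. [folklore] -/
theorem integral_centredSource_pow_four_le (D : ℕ) (lam m : ℝ) (n : ℕ) (B : Finset (Site 4)) :
    Integrable (fun Y : ZdPlaquette 4 → Fin D → ℝ =>
        (∑ x ∈ B, ((lam / 2 * (∑ a : Fin D, (Y (plaquette12 (d := 4) (by norm_num) x) a) ^ 2) -
              lam / 2 * D * curvaturePlaquetteCorr (d := 4) (by norm_num) 0) *
            (lam / 2 * (∑ a : Fin D, (Y (plaquette12 (d := 4) (by norm_num) (x + Pi.single (0 : Fin 4) (n : ℤ))) a) ^ 2) -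
              lam / 2 * D * curvaturePlaquetteCorr (d := 4) (by norm_num) 0) - m)) ^ 4)
      (curvatureGaussianField (d := 4) D) ∧
    ∫ Y, (∑ x ∈ B, ((lam / 2 * (∑ a : Fin D, (Y (plaquette12 (d := 4) (by norm_num) x) a) ^ 2) -
              lam / 2 * D * curvaturePlaquetteCorr (d := 4) (by norm_num) 0) *
            (lam / 2 * (∑ a : Fin D, (Y (plaquette12 (d := 4) (by norm_num) (x + Pi.single (0 : Fin 4) (n : ℤ))) a) ^ 2) -
              lam / 2 * D * curvaturePlaquetteCorr (d := 4) (by norm_num) 0) - m)) ^ 4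
        ∂curvatureGaussianField (d := 4) D ≤
      (B.card : ℝ) ^ 4 * (8 * (128 * ((lam / 2) ^ 8 * ((D : ℝ) ^ 7 * (D * (((15‼ : ℕ) : ℝ) * (1 / 2) ^ 8))) +
        (lam / 2 * D * curvaturePlaquetteCorr (d := 4) (by norm_num) 0) ^ 8) + m ^ 4)) := by
  have hd : 3 ≤ 4 := by norm_num
  set γ := curvatureGaussianField (d := 4) D with hγ
  haveI := isProbabilityMeasure_curvatureGaussianField hd D
  have hX := isGaussianProcess_eval_curvatureGaussianField (d := 4) hd D
  set v : Site 4 := Pi.single (0 : Fin 4) (n : ℤ) with hv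
  set C0 : ℝ := curvaturePlaquetteCorr (d := 4) hd 0 with hC0
  set K4 : ℝ := 8 * (128 * ((lam / 2) ^ 8 * ((D : ℝ) ^ 7 * (D * (((15‼ : ℕ) : ℝ) * (1 / 2) ^ 8))) +
    (lam / 2 * D * C0) ^ 8) + m ^ 4) with hK4
  set c : Site 4 → (ZdPlaquette 4 → Fin D → ℝ) → ℝ := fun x Y =>
    (lam / 2 * (∑ a : Fin D, (Y (plaquette12 (d := 4) hd x) a) ^ 2) - lam / 2 * D * C0) *
        (lam / 2 * (∑ a : Fin D, (Y (plaquette12 (d := 4) hd (x + v)) a) ^ 2) - lam / 2 * D * C0) - m with hc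
  -- integrability of the fourth power of the centred source (a polynomial) and of the site terms
  have hI : ∀ r : MvPolynomial (ZdPlaquette 4 × Fin D) ℝ,
      Integrable (fun Y : ZdPlaquette 4 → Fin D → ℝ => MvPolynomial.eval (fun s => Y s.1 s.2) r) γ := fun r =>
    integrable_mvPolynomial_eval hX id r
  set r : Site 4 → MvPolynomial (ZdPlaquette 4 × Fin D) ℝ := fun x =>
    (MvPolynomial.C (lam / 2) * (∑ a : Fin D, MvPolynomial.X (plaquette12 (d := 4) hd x, a) ^ 2) -
        MvPolynomial.C (lam / 2 * D * C0)) *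
      (MvPolynomial.C (lam / 2) * (∑ a : Fin D, MvPolynomial.X (plaquette12 (d := 4) hd (x + v), a) ^ 2) -
        MvPolynomial.C (lam / 2 * D * C0)) - MvPolynomial.C m with hr
  have iZ4 : Integrable (fun Y => (∑ x ∈ B, c x Y) ^ 4) γ :=
    (hI ((∑ x ∈ B, r x) ^ 4)).congr (ae_of_all _ fun Y => by simp [hr, hc, map_sum])
  have hsite : ∀ x : Site 4, Integrable (fun Y => c x Y ^ 4) γ ∧ ∫ Y, c x Y ^ 4 ∂γ ≤ K4 := fun x =>
    integral_siteTerm_sub_pow_four_le D lam m (plaquette12 (d := 4) hd x) (plaquette12 (d := 4) hd (x + v))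
  refine ⟨iZ4, ?_⟩
  -- power mean, pointwise
  have hpt : ∀ Y, (∑ x ∈ B, c x Y) ^ 4 ≤ (B.card : ℝ) ^ 3 * ∑ x ∈ B, c x Y ^ 4 := by
    intro Y
    have h1 : (∑ x ∈ B, c x Y) ^ 4 ≤ (∑ x ∈ B, |c x Y|) ^ 4 :=
      calc (∑ x ∈ B, c x Y) ^ 4 = |∑ x ∈ B, c x Y| ^ 4 := ((by decide : Even 4).pow_abs _).symm
        _ ≤ (∑ x ∈ B, |c x Y|) ^ 4 := pow_le_pow_left₀ (abs_nonneg _) (Finset.abs_sum_le_sum_abs _ _) 4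
    have h2 := pow_sum_le_card_mul_sum_pow (s := B) (f := fun x => |c x Y|) (fun x _ => abs_nonneg _) 3
    have h3 : ∑ x ∈ B, |c x Y| ^ (3 + 1) = ∑ x ∈ B, c x Y ^ 4 := Finset.sum_congr rfl fun x _ =>
      (by decide : Even (3 + 1)).pow_abs _
    rw [h3] at h2
    exact h1.trans h2
  have iR : Integrable (fun Y => (B.card : ℝ) ^ 3 * ∑ x ∈ B, c x Y ^ 4) γ :=
    (integrable_finsetSum _ fun x _ => (hsite x).1).const_mul _
  calc ∫ Y, (∑ x ∈ B, c x Y) ^ 4 ∂γ ≤ ∫ Y, (B.card : ℝ) ^ 3 * ∑ x ∈ B, c x Y ^ 4 ∂γ := integral_mono iZ4 iR hpt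
    _ = (B.card : ℝ) ^ 3 * ∑ x ∈ B, ∫ Y, c x Y ^ 4 ∂γ := by
        rw [integral_const_mul, integral_finsetSum _ (fun x _ => (hsite x).1)]
    _ ≤ (B.card : ℝ) ^ 3 * ∑ _x ∈ B, K4 := by
        gcongr with x _
        exact (hsite x).2
    _ = (B.card : ℝ) ^ 4 * K4 := by rw [Finset.sum_const, nsmul_eq_mul]; ring

end Summit.QuantumFields.YangMills.Cruxes.SourcedPressureIncrement.Birth
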